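import Literature.NumberTheory.ComplexMultiplication.FiniteQAlgebraLatticeSplitOrders
import Literature.NumberTheory.ComplexMultiplication.FiniteQAlgebraLatticeRadicalProjectionInjective
import HarnessLib

/-!
# Hertling–Larabi's triangular `ℤ`-bases (9.1) and (10.2) IN COORDINATES: every full lattice of a finite-dimensional
# `ℚ`-algebra has, with respect to ANY `ℚ`-basis, exactly one `ℤ`-basis with upper (resp. lower) triangular
# centred coordinate matrix — general rank `n`

[topic NumberTheory/ComplexMultiplication] Lane `lit-hodgefound` (Track 2 foundations library), seat p19 generation
42, rows g42-#8 (§1–§4), g42-#11 (§5–§6: the orders, (10.4); (10.2)/(10.4) as printed for `ℚ[a]/(aⁿ)`) and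
g42-#12 (§5 generalised to `1 ∈ Λ ⊆ ℤ·1 ⊕ ker π`; §7: the semi-normal form (10.3), general `n` and as printed).
THEOREMS ONLY: no definition, no instance, no notation, no named fact (D-0026, net Literature debt
`0`), no `sorry`.  REUSES `FiniteQAlgebraLatticeSplitOrders` (p19 g42-#2: `existsUnique_basis_centered` — (9.1) for
the full lattices of `ℚⁿ` —, `span_cols_eq_iff_exists_isUnit`, `exists_det_ne_zero_span_cols_eq`) and
`LinearAlgebra/Matrix/HermiteNormalFormWindows` §8 (p19 g42-#7: `existsUnique_mul_centered_lower_rat` — (10.2),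
matrix side), `FiniteQAlgebraLatticeSquareZeroRadical.exists_intCast_eq_map_of_one_mem` (`π(Λ) = ℤ` for an order)
and `FiniteQAlgebraLatticeRadicalProjectionInjective` (§3–§4: units lift along a character with nil kernel;
`ℚ[a]/(aⁿ) = AdjoinRoot (X ^ n)` is local).

## Source, VERBATIM

C. Hertling, K. Larabi, *Conjugacy classes of regular integer matrices*, arXiv:2602.15748 (2026)
[HertlingLarabi2026b], held `paper:arxiv-2602.15748`.
* §9.1, chunk p0027 (`A = ℚe₁ + ⋯ + ℚeₙ`, `e = (e₁, …, eₙ)`): «Each full lattice `L ∈ 𝓛(A)` has a unique `ℤ`-basis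
  of the shape `e·(β₁₁ β₁₂ ⋯ β₁ₙ; 0 β₂₂ ⋯ β₂ₙ; ⋮ ⋱ ⋱ ⋮; 0 ⋯ 0 βₙₙ)` with `β_{ii} ∈ ℚ_{>0}` for `1 ≤ i ≤ n` and
  `β_{ij} ∈ (−½β_{ii}, ½β_{ii}] ∩ ℚ` for `i < j`. (9.1)»
* §10.1, chunk p0033 (`A = ℚ·1_A ⊕ ℚ·a + ⋯ + ℚ·a^{n−1}` with `aⁿ = 0`): «Write `a := (1_A, a, a², …, a^{n−1})`.
  Each full lattice `L ∈ 𝓛(A)` has a unique `ℤ`-basis of the shape `a·(β₁₁ 0 ⋯ 0; β₂₁ β₂₂ ⋱ ⋮; ⋮ ⋱ ⋱ 0;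
  βₙ₁ ⋯ β_{n,n−1} βₙₙ)` with `β_{ii} ∈ ℚ_{>0}` for `1 ≤ i ≤ n` and `β_{ij} ∈ (−½β_{ii}, ½β_{ii}] ∩ ℚ` for `i > j`.
  (10.2)»; «Each order `Λ` in `A` satisfies `ℤ·1_A ⊂ Λ ⊂ ℤ·1_A ⊕ N` because of the proof of Lemma 10.1. It has a
  unique `ℤ`-basis of the shape `a·(1 0 ⋯ 0; 0 α₂₂ ⋱ ⋮; ⋮ ⋮ ⋱ 0; 0 α_{n2} ⋯ α_{nn})` with `α_{ii} ∈ ℚ_{>0}` for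
  `2 ≤ i < n` and `α_{ij} ∈ (−½α_{ii}, ½α_{ii}] ∩ ℚ` for `i > j ≥ 2`. (10.4)» (proof of Lemma 10.1, same chunk:
  «`F = ℚ·1_A ⊂ A` has only one order, the order `Λ_0 := ℤ·1_A` […] Under the projection `pr_F : A → F` […] each
  order `Λ` is mapped to `Λ_0`»); «Multiplication of `L` with the unit `u = (Σ_{i=1}^n β_{i1}a^{i−1})⁻¹ ∈ A^{unit}`
  leads to the full lattice `uL` which has a `ℤ`-basis of the shape `a·(1 0 ⋯ 0; 0 γ₂₂ ⋱ ⋮; ⋮ ⋮ ⋱ 0;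
  0 γ_{n2} ⋯ γ_{nn})` with `γ_{ii} ∈ ℚ_{>0}` for `2 ≤ i ≤ n` and `γ_{ij} ∈ (−½γ_{ii}, ½γ_{ii}] ∩ ℚ` for `i > j ≥ 2`
  (10.3). Though this is not unique. It is only a semi-normal form, because one can add multiples of the other
  columns to the first column and multiply `u·L` with a new unit similar to the one above.»
In both displays `e·β` resp. `a·β` is the row of the `n` lattice vectors `Σ_i β_{ij} vᵢ` (`j = 1, …, n`): the
COLUMNS of `β` are the coordinate vectors of the basis in the chosen `ℚ`-basis `v` of `A`.  Neither statement uses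
the multiplication of `A` — only that `L` is a full lattice (finitely generated, `ℚL = A`) and that `v` is a
`ℚ`-basis —, so both hold for every `ℚ`-basis `v` of every finite-dimensional `ℚ`-algebra; this file proves them in
that generality (the tree's `IsFullLattice A L` is stated for rings `A`, which is the only reason `A` is an algebra
here rather than a vector space).

## What is proved (`v : Basis (Fin n) ℚ A`, `L : Submodule ℤ A` with `IsFullLattice A L`, `β : Matrix (Fin n) (Fin n) ℚ`)

* §1 `existsUnique_basis_centered_lower` — the companion of `SplitOrders.existsUnique_basis_centered` for the full
  lattices of `ℚⁿ` in the LOWER triangular shape of (10.2) (from `existsUnique_mul_centered_lower_rat`).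
* §2 transport: `isFullLattice_map_linearEquiv` (a `ℤ`-linear image of a full lattice under a `ℚ`-linear
  isomorphism is a full lattice), `span_coords_eq_iff` (the columns of `β` span `v.equivFun(L)` iff the vectors
  `Σ_i β_{ij} vᵢ` span `L`).
* §3 **`existsUnique_coords_centered`** — (9.1) in coordinates: there is exactly one upper triangular `β` with
  `β_{ii} > 0`, `−β_{ii} < 2β_{ij} ≤ β_{ii}` (`i < j`) such that the `ℤ`-span of `(Σ_i β_{ij} vᵢ)_j` is `L`;
  **`existsUnique_coords_centered_lower`** — (10.2) in coordinates (the same with `β` lower triangular and the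
  window condition for `i > j`); in particular for `v = a = (1, a, …, a^{n−1})` this is (10.2) as printed.
* §4 «a `ℤ`-basis»: `linearIndependent_coords` (for `det β ≠ 0` the vectors `Σ_i β_{ij} vᵢ` are `ℤ`-linearly
  independent), `linearIndependent_coords_of_upperTriangular`, `linearIndependent_coords_of_lowerTriangular` (the
  shapes of §3: triangular with positive diagonal), so the spanning family of §3 is a `ℤ`-basis of `L`.
* §5 **`existsUnique_coords_centered_lower_of_one_mem`** (full lattices `Λ` with `1 ∈ Λ` and `π(Λ) ⊆ ℤ`, i.e.
  `ℤ·1 ⊆ Λ ⊆ ℤ·1 ⊕ ker π` — the common content of (10.3)/(10.4)) and its corollary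
  **`existsUnique_order_coords_centered_lower`** — (10.4) in coordinates: for an algebra character
  `π : A →ₐ[ℚ] ℚ` (commutative `A`) and a `ℚ`-basis `v = (v₀, …, v_m)` with `v₀ = 1`, `π(vᵢ) = 0` (`i ≥ 1`), every
  ORDER `Λ` has exactly one lower triangular centred `α ∈ M_m(ℚ)` with positive diagonal such that
  `span ℤ ({1} ∪ {Σ_i α_{ij} vᵢ}_j) = Λ` (`π(Λ) = ℤ` by `FiniteQAlgebraLattice.exists_intCast_eq_map_of_one_mem`, so
  `Λ = ℤ·1 ⊕ (Λ ∩ ker π)`; the coordinates `i ≥ 1` carry `Λ` onto a full lattice of `ℚᵐ`).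
* §6 AS PRINTED for `A = ℚ[a]/(aⁿ) = AdjoinRoot (X ^ n)` and the power basis `a = (1, a, …, a^{n−1})`:
  **`adjoinRoot_X_pow_existsUnique_coords_centered_lower`** ((10.2)) and
  **`adjoinRoot_X_pow_existsUnique_order_coords`** ((10.4), `n = m + 1`).
* §7 **`exists_units_smul_existsUnique_coords_semiNormal`** — (10.3) in coordinates, general `n`, for a LOCAL
  algebra (`ker π` nil): `∃ u ∈ A^{unit}` with `u⁻¹ ∈ L` (the first vector of the basis (10.2) of `L`, a unit by
  `FiniteQAlgebraLattice.isUnit_of_isUnit_map_of_forall_isNilpotent`) and a UNIQUE lower triangular centred `γ` with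
  `span ℤ ({1} ∪ {Σ_i γ_{ij} vᵢ}_j) = uL`; `isFullLattice_units_smul`; AS PRINTED:
  **`adjoinRoot_X_pow_exists_units_smul_semiNormal`** (`ℚ[a]/(aⁿ)`, `n = m + 1`).
NOT here: the semi-normal form (9.2) of the split algebra (`SplitOrders.exists_units_smul_eq_span_semiNormal`), the
non-uniqueness discussion of (10.3) («one can add multiples of the other columns to the first column»), the extra
multiplicativity constraints on `(α_{ij})` for `n ≥ 3` («gives additional constraints on the entries»).
-/

open Matrix Module Submodule
open scoped Pointwise

namespace Literature.NumberTheory.ComplexMultiplication.FiniteQAlgebraLattice.TriangularBases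

open Literature.NumberTheory.Automorphic (IsFullLattice)
open Literature.LinearAlgebra.Matrix.HermiteNormalFormWindows (existsUnique_mul_centered_lower_rat)
open Literature.NumberTheory.ComplexMultiplication.FiniteQAlgebraLattice.SplitOrders (existsUnique_basis_centered
  span_cols_eq_iff_exists_isUnit exists_det_ne_zero_span_cols_eq)

/-! ## §1 Full lattices of `ℚⁿ`: the lower triangular centred basis -/

/-- **(10.2) for the full lattices of `ℚⁿ`**: for a full lattice `L ⊂ ℚⁿ` there is exactly one LOWER triangular
rational matrix `β` (`β i j = 0` for `i < j`) with `β_{ii} > 0` and `−β_{ii} < 2β_{ij} ≤ β_{ii}` (`j < i`) whose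
columns span `L` over `ℤ`. [cite: HertlingLarabi2026b, §10.1 (10.2), chunk p0033] -/
theorem existsUnique_basis_centered_lower {n : ℕ} {L : Submodule ℤ (Fin n → ℚ)}
    (hL : IsFullLattice (Fin n → ℚ) L) :
    ∃! β : Matrix (Fin n) (Fin n) ℚ, (∀ i j, i < j → β i j = 0) ∧ (∀ i, 0 < β i i) ∧
      (∀ i j, j < i → -β i i < 2 * β i j ∧ 2 * β i j ≤ β i i) ∧ span ℤ (Set.range fun j i => β i j) = L := by
  obtain ⟨B, hB, hBL⟩ := exists_det_ne_zero_span_cols_eq hL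
  refine (existsUnique_congr fun H => ?_).1 (existsUnique_mul_centered_lower_rat B hB)
  rw [← span_cols_eq_iff_exists_isUnit B H hB, hBL]
  constructor
  · rintro ⟨h1, h2, h3, h4⟩; exact ⟨h2, h3, h4, h1⟩
  · rintro ⟨h2, h3, h4, h1⟩; exact ⟨h1, h2, h3, h4⟩

/-! ## §2 Transport along a `ℚ`-basis -/

section Transport

variable {A : Type*} [Ring A] [Algebra ℚ A] {A' : Type*} [Ring A'] [Algebra ℚ A']

/-- The image of a full lattice under a `ℚ`-linear isomorphism (only the additive structure is used: finitely
generated, and every vector has a nonzero integer multiple in the lattice) is a full lattice.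
[cite: HertlingLarabi2026b, §4 Def. 4.1 (a), chunk p0007] -/
theorem isFullLattice_map_linearEquiv (e : A ≃ₗ[ℚ] A') {L : Submodule ℤ A} (hL : IsFullLattice A L) :
    IsFullLattice A' (L.map (e.restrictScalars ℤ : A ≃ₗ[ℤ] A').toLinearMap) := by
  refine ⟨hL.1.map _, fun d => ?_⟩
  obtain ⟨k, hk, hkd⟩ := hL.2 (e.symm d)
  refine ⟨k, hk, Submodule.mem_map.2 ⟨_, hkd, ?_⟩⟩
  rw [map_zsmul]
  exact congrArg (fun x : A' => k • x) (e.apply_symm_apply d)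

/-- **Coordinates**: for a `ℚ`-basis `v` of `A` and a rational matrix `β`, the columns of `β` span the coordinate
image `v.equivFun(L) ⊂ ℚⁿ` of `L` over `ℤ` iff the vectors `Σ_i β_{ij} vᵢ` (`j = 1, …, n`) span `L` over `ℤ`.
[cite: HertlingLarabi2026b, §9.1 (9.1) (the notation `e·β`), chunk p0027] -/
theorem span_coords_eq_iff {n : ℕ} (v : Basis (Fin n) ℚ A) (L : Submodule ℤ A) (β : Matrix (Fin n) (Fin n) ℚ) :
    span ℤ (Set.range fun j i => β i j) =
        L.map (v.equivFun.restrictScalars ℤ : A ≃ₗ[ℤ] (Fin n → ℚ)).toLinearMap ↔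
      span ℤ (Set.range fun j => ∑ i, β i j • v i) = L := by
  set e : A ≃ₗ[ℤ] (Fin n → ℚ) := v.equivFun.restrictScalars ℤ with he
  have hcol : (fun j i => β i j) = e.toLinearMap ∘ fun j => ∑ i, β i j • v i := by
    funext j
    rw [Function.comp_apply, LinearEquiv.coe_toLinearMap, he, LinearEquiv.restrictScalars_apply,
      ← v.equivFun_symm_apply, LinearEquiv.apply_symm_apply]
  rw [hcol, Set.range_comp, Submodule.span_image, (Submodule.map_injective_of_injective e.injective).eq_iff]

end Transport

/-! ## §3 (9.1) and (10.2) with respect to an arbitrary `ℚ`-basis -/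

section Coordinates

variable {A : Type*} [Ring A] [Algebra ℚ A]

/-- **HERTLING–LARABI (9.1) IN COORDINATES, general `n`**: for a `ℚ`-basis `v = (v₁, …, vₙ)` of a
finite-dimensional `ℚ`-algebra `A` and a full lattice `L ⊂ A` there is exactly one upper triangular rational matrix
`β` with `β_{ii} > 0` and `−β_{ii} < 2β_{ij} ≤ β_{ii}` for `i < j` such that `v·β = (Σ_i β_{ij} vᵢ)_{j}` spans `L`
over `ℤ` («Each full lattice `L ∈ 𝓛(A)` has a unique `ℤ`-basis of the shape `e·(β_{ij})` …» — printed for the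
split algebra and its idempotent basis `e`; the statement only uses that `e` is a `ℚ`-basis).
[cite: HertlingLarabi2026b, §9.1 (9.1), chunk p0027] -/
theorem existsUnique_coords_centered {n : ℕ} (v : Basis (Fin n) ℚ A) {L : Submodule ℤ A}
    (hL : IsFullLattice A L) :
    ∃! β : Matrix (Fin n) (Fin n) ℚ, β.BlockTriangular id ∧ (∀ i, 0 < β i i) ∧
      (∀ i j, i < j → -β i i < 2 * β i j ∧ 2 * β i j ≤ β i i) ∧ span ℤ (Set.range fun j => ∑ i, β i j • v i) = L := by
  have hL' := isFullLattice_map_linearEquiv v.equivFun hL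
  refine (existsUnique_congr fun β => ?_).1 (existsUnique_basis_centered hL')
  rw [span_coords_eq_iff v L β]

/-- **HERTLING–LARABI (10.2) IN COORDINATES, general `n`** — «Write `a := (1_A, a, a², …, a^{n−1})`. Each full
lattice `L ∈ 𝓛(A)` has a unique `ℤ`-basis of the shape `a·(β_{ij})` [lower triangular] with `β_{ii} ∈ ℚ_{>0}` for
`1 ≤ i ≤ n` and `β_{ij} ∈ (−½β_{ii}, ½β_{ii}] ∩ ℚ` for `i > j`»: for ANY `ℚ`-basis `v` of a finite-dimensional
`ℚ`-algebra `A` (in particular `v = a` for `A = ℚ[a]/(aⁿ)`) and a full lattice `L ⊂ A` there is exactly one lower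
triangular rational `β` (`β i j = 0` for `i < j`) with `β_{ii} > 0` and `−β_{ii} < 2β_{ij} ≤ β_{ii}` for `j < i`
such that `(Σ_i β_{ij} vᵢ)_j` spans `L` over `ℤ`. [cite: HertlingLarabi2026b, §10.1 (10.2), chunk p0033] -/
theorem existsUnique_coords_centered_lower {n : ℕ} (v : Basis (Fin n) ℚ A) {L : Submodule ℤ A}
    (hL : IsFullLattice A L) :
    ∃! β : Matrix (Fin n) (Fin n) ℚ, (∀ i j, i < j → β i j = 0) ∧ (∀ i, 0 < β i i) ∧
      (∀ i j, j < i → -β i i < 2 * β i j ∧ 2 * β i j ≤ β i i) ∧ span ℤ (Set.range fun j => ∑ i, β i j • v i) = L := by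
  have hL' := isFullLattice_map_linearEquiv v.equivFun hL
  refine (existsUnique_congr fun β => ?_).1 (existsUnique_basis_centered_lower hL')
  rw [span_coords_eq_iff v L β]

end Coordinates

/-! ## §4 The spanning vectors are a `ℤ`-basis -/

section Basis

variable {A : Type*} [Ring A] [Algebra ℚ A]

/-- **«a `ℤ`-basis»**: for a nonsingular rational coordinate matrix `β` the vectors `Σ_i β_{ij} vᵢ` (`j = 1, …, n`)
are `ℤ`-linearly independent (they are `ℚ`-linearly independent: the columns of `β` are, and `x ↦ Σ_i xᵢvᵢ` is a
`ℚ`-linear isomorphism). [cite: HertlingLarabi2026b, §9.1 (9.1) («a unique `ℤ`-basis of the shape `e·β`»), chunk p0027] -/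
theorem linearIndependent_coords {n : ℕ} (v : Basis (Fin n) ℚ A) {β : Matrix (Fin n) (Fin n) ℚ} (hβ : β.det ≠ 0) :
    LinearIndependent ℤ (fun j => ∑ i, β i j • v i) := by
  have h1 : LinearIndependent ℚ (fun j => ∑ i, β i j • v i) := by
    have h2 : (fun j => ∑ i, β i j • v i) = (v.equivFun.symm : (Fin n → ℚ) →ₗ[ℚ] A) ∘ β.col := by
      funext j
      rw [Function.comp_apply, LinearEquiv.coe_coe, v.equivFun_symm_apply]
      rfl
    rw [h2]
    exact (Matrix.linearIndependent_cols_of_det_ne_zero hβ).map' _ v.equivFun.symm.ker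
  exact h1.restrict_scalars fun r s h => by simpa using h

/-- The shape (9.1): an upper triangular `β` with positive diagonal is nonsingular, so `(Σ_i β_{ij} vᵢ)_j` is
`ℤ`-linearly independent — together with `existsUnique_coords_centered` a `ℤ`-basis of `L`.
[cite: HertlingLarabi2026b, §9.1 (9.1), chunk p0027] -/
theorem linearIndependent_coords_of_upperTriangular {n : ℕ} (v : Basis (Fin n) ℚ A) {β : Matrix (Fin n) (Fin n) ℚ}
    (hT : β.BlockTriangular id) (hpos : ∀ i, 0 < β i i) : LinearIndependent ℤ (fun j => ∑ i, β i j • v i) := by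
  refine linearIndependent_coords v ?_
  rw [Matrix.det_of_upperTriangular hT]
  exact (Finset.prod_pos fun i _ => hpos i).ne'

/-- The shape (10.2): a lower triangular `β` with positive diagonal is nonsingular, so `(Σ_i β_{ij} vᵢ)_j` is
`ℤ`-linearly independent — together with `existsUnique_coords_centered_lower` a `ℤ`-basis of `L`.
[cite: HertlingLarabi2026b, §10.1 (10.2), chunk p0033] -/
theorem linearIndependent_coords_of_lowerTriangular {n : ℕ} (v : Basis (Fin n) ℚ A) {β : Matrix (Fin n) (Fin n) ℚ}
    (hT : ∀ i j, i < j → β i j = 0) (hpos : ∀ i, 0 < β i i) : LinearIndependent ℤ (fun j => ∑ i, β i j • v i) := by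
  refine linearIndependent_coords v ?_
  rw [Matrix.det_of_lowerTriangular β fun i j hij => hT i j (OrderDual.toDual_lt_toDual.1 hij)]
  exact (Finset.prod_pos fun i _ => hpos i).ne'

end Basis

/-! ## §5 (10.4): the unique `ℤ`-basis of an ORDER in a unital basis adapted to a character

«Each order `Λ` in `A` satisfies `ℤ·1_A ⊂ Λ ⊂ ℤ·1_A ⊕ N` because of the proof of Lemma 10.1. It has a unique
`ℤ`-basis of the shape `a·(1 0 ⋯ 0; 0 α₂₂ ⋱ ⋮; ⋮ ⋮ ⋱ 0; 0 α_{n2} ⋯ α_{nn})` with `α_{ii} ∈ ℚ_{>0}` for `2 ≤ i < n`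
and `α_{ij} ∈ (−½α_{ii}, ½α_{ii}] ∩ ℚ` for `i > j ≥ 2`. (10.4)» (chunk p0033; `A = ℚ[a]/(aⁿ)`, `N` its nilpotent
part).  What the proof uses: `1_A` is the first basis vector, the other basis vectors span the kernel `N` of the
algebra character `pr_F : A → F = ℚ`, and `pr_F(Λ) = ℤ` for every order (the tree's
`FiniteQAlgebraLattice.exists_intCast_eq_map_of_one_mem`).  So the statement holds for every commutative
finite-dimensional `ℚ`-algebra `A`, every character `π : A →ₐ[ℚ] ℚ` and every `ℚ`-basis `v = (v₀, v₁, …, v_m)` with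
`v₀ = 1` and `π(v_i) = 0` for `i ≥ 1` (for the split algebra and `π = pr_n` this is the pattern of (9.3),
`SplitOrders.existsUnique_basis_of_isOrder`, with the unital vector last and the upper triangular shape). -/

section Orders

variable {A : Type} [CommRing A] [Algebra ℚ A]

open Literature.NumberTheory.ComplexMultiplication.FiniteQAlgebraLattice (exists_intCast_eq_map_of_one_mem)

/-- `π(x)` is the coefficient of `v₀ = 1` when the other basis vectors lie in `ker π`. [folklore] -/
private theorem map_eq_repr_zero (π : A →ₐ[ℚ] ℚ) {m : ℕ} (v : Basis (Fin (m + 1)) ℚ A) (hv0 : v 0 = 1)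
    (hvπ : ∀ i : Fin m, π (v i.succ) = 0) (x : A) : π x = v.repr x 0 := by
  conv_lhs => rw [← v.sum_repr x]
  rw [map_sum, Fin.sum_univ_succ, Finset.sum_eq_zero (fun i _ => by rw [map_smul, hvπ, smul_zero]), add_zero,
    map_smul, hv0, map_one, smul_eq_mul, mul_one]

/-- `x = (v.repr x 0)·1 + Σ_{i ≥ 1} (v.repr x i)·vᵢ` when `v₀ = 1`. [folklore] -/
private theorem eq_smul_one_add_sum {m : ℕ} (v : Basis (Fin (m + 1)) ℚ A) (hv0 : v 0 = 1) (x : A) :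
    x = v.repr x 0 • (1 : A) + ∑ i : Fin m, v.repr x i.succ • v i.succ := by
  conv_lhs => rw [← v.sum_repr x]
  rw [Fin.sum_univ_succ, hv0]

/-- The coordinates of `Σ_{i ≥ 1} yᵢ vᵢ` are `(0, y₁, …, y_m)`. [folklore] -/
private theorem repr_sum_smul_succ {m : ℕ} (v : Basis (Fin (m + 1)) ℚ A) (y : Fin m → ℚ) (k : Fin (m + 1)) :
    v.repr (∑ i, y i • v i.succ) k = (Fin.cons 0 y : Fin (m + 1) → ℚ) k := by
  have e : (∑ i, y i • v i.succ) = v.equivFun.symm (Fin.cons 0 y) := by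
    rw [v.equivFun_symm_apply, Fin.sum_univ_succ, Fin.cons_zero, zero_smul, zero_add]
    simp only [Fin.cons_succ]
  rw [e, ← v.equivFun_apply, LinearEquiv.apply_symm_apply]

/-- **Full lattices with `1 ∈ Λ ⊆ ℤ·1 ⊕ ker π` have a unique `ℤ`-basis `(1, w₁, …, w_m)` with lower triangular centred
coordinates** — the common content of (10.3) and (10.4): for an algebra character `π : A →ₐ[ℚ] ℚ` (commutative
`A`), a `ℚ`-basis `v = (v₀, …, v_m)` with `v₀ = 1`, `π(vᵢ) = 0` (`i ≥ 1`), and a full lattice `Λ` with `1 ∈ Λ` and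
`π(Λ) ⊆ ℤ`, there is exactly one lower triangular `α ∈ M_m(ℚ)` with `α_{ii} > 0`, `−α_{ii} < 2α_{ij} ≤ α_{ii}`
(`i > j`) such that `span ℤ ({1} ∪ {Σ_i α_{ij} vᵢ}_j) = Λ` (`Λ = ℤ·1 ⊕ (Λ ∩ ker π)`, and the coordinates `i ≥ 1`
carry `Λ` onto a full lattice of `ℚᵐ`, to which §1 applies).
[cite: HertlingLarabi2026b, §10.1 (10.3)–(10.4) with the proof of Lemma 10.1, chunk p0033] -/
theorem existsUnique_coords_centered_lower_of_one_mem (π : A →ₐ[ℚ] ℚ) {m : ℕ} (v : Basis (Fin (m + 1)) ℚ A)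
    (hv0 : v 0 = 1) (hvπ : ∀ i : Fin m, π (v i.succ) = 0) {Λ : Submodule ℤ A} (hΛ : IsFullLattice A Λ)
    (h1 : (1 : A) ∈ Λ) (hint : ∀ x ∈ Λ, ∃ n : ℤ, (n : ℚ) = π x) :
    ∃! α : Matrix (Fin m) (Fin m) ℚ, (∀ i j, i < j → α i j = 0) ∧ (∀ i, 0 < α i i) ∧
      (∀ i j, j < i → -α i i < 2 * α i j ∧ 2 * α i j ≤ α i i) ∧
      span ℤ (insert (1 : A) (Set.range fun j => ∑ i, α i j • v i.succ)) = Λ := by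
  classical
  -- the coordinate map `c : x ↦ (v.repr x 1, …, v.repr x m)` (forgets the coefficient of `v₀ = 1`)
  let cQ : A →ₗ[ℚ] (Fin m → ℚ) :=
    LinearMap.pi fun i => (Finsupp.lapply i.succ) ∘ₗ (v.repr : A →ₗ[ℚ] (Fin (m + 1) →₀ ℚ))
  let c : A →ₗ[ℤ] (Fin m → ℚ) := cQ.restrictScalars ℤ
  have hc : ∀ x i, c x i = v.repr x i.succ := fun x i => rfl
  have hc1 : c 1 = 0 := by
    funext i
    rw [hc, ← hv0, v.repr_self, Finsupp.single_apply, if_neg (Fin.succ_ne_zero i).symm]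
    rfl
  have hcw : ∀ y : Fin m → ℚ, c (∑ i, y i • v i.succ) = y := fun y => by
    funext i; rw [hc, repr_sum_smul_succ, Fin.cons_succ]
  have hπw : ∀ y : Fin m → ℚ, π (∑ i, y i • v i.succ) = 0 := fun y => by
    rw [map_eq_repr_zero π v hv0 hvπ, repr_sum_smul_succ, Fin.cons_zero]
  have hker : ∀ x, π x = 0 → x = ∑ i, c x i • v i.succ := fun x hx => by
    have e := eq_smul_one_add_sum v hv0 x
    rw [← map_eq_repr_zero π v hv0 hvπ, hx, zero_smul, zero_add] at e
    exact e
  -- `c(Λ)` is a full lattice of `ℚᵐ`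
  have hfull : IsFullLattice (Fin m → ℚ) (Λ.map c) := by
    refine ⟨hΛ.1.map _, fun y => ?_⟩
    obtain ⟨k, hk, hkx⟩ := hΛ.2 (∑ i, y i • v i.succ)
    refine ⟨k, hk, Submodule.mem_map.2 ⟨_, hkx, ?_⟩⟩
    rw [map_zsmul, hcw]
  have hsub : ∀ x ∈ Λ, ∀ n : ℤ, (n : ℚ) = π x → x - n • (1 : A) ∈ Λ ∧ π (x - n • (1 : A)) = 0 :=
    fun x hx n hn => ⟨Λ.sub_mem hx (Λ.smul_mem n h1), by
      rw [map_sub, map_zsmul, map_one, ← hn, zsmul_eq_mul, mul_one, sub_self]⟩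
  -- the dictionary between `ℚᵐ` and `A`
  have key : ∀ α : Matrix (Fin m) (Fin m) ℚ,
      span ℤ (Set.range fun j i => α i j) = Λ.map c ↔
        span ℤ (insert (1 : A) (Set.range fun j => ∑ i, α i j • v i.succ)) = Λ := by
    intro α
    have hcw' : (fun j i => α i j) = c ∘ fun j => ∑ i, α i j • v i.succ := by
      funext j; exact (hcw _).symm
    have hmapW : (span ℤ (insert (1 : A) (Set.range fun j => ∑ i, α i j • v i.succ))).map c =
        span ℤ (Set.range fun j i => α i j) := by
      rw [Submodule.map_span, Set.image_insert_eq, hc1, Submodule.span_insert_zero, ← Set.range_comp, hcw']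
    constructor
    · intro hα
      apply le_antisymm
      · rw [Submodule.span_le]
        rintro x (rfl | ⟨j, rfl⟩)
        · exact h1
        · have hj : (fun i => α i j) ∈ Λ.map c := by
            rw [← hα]; exact Submodule.subset_span ⟨j, rfl⟩
          obtain ⟨z, hz, hzj⟩ := Submodule.mem_map.1 hj
          obtain ⟨nz, hnz⟩ := hint z hz
          obtain ⟨hz', hπz'⟩ := hsub z hz nz hnz
          have hcz' : c (z - nz • (1 : A)) = fun i => α i j := by
            rw [map_sub, map_zsmul, hc1, smul_zero, sub_zero, hzj]
          have e := hker _ hπz'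
          rw [hcz'] at e
          -- `e : z - nz • 1 = ∑ i, α i j • v i.succ`
          have e' : (∑ i, α i j • v i.succ) = z - nz • (1 : A) := e.symm
          show (∑ i, α i j • v i.succ) ∈ Λ
          rw [e']
          exact hz'
      · intro x hx
        obtain ⟨nx, hnx⟩ := hint x hx
        obtain ⟨hx', hu⟩ := hsub x hx nx hnx
        have hcu : c (x - nx • (1 : A)) ∈ (span ℤ (Set.range fun j => ∑ i, α i j • v i.succ)).map c := by
          rw [Submodule.map_span, ← Set.range_comp, ← hcw', hα]
          exact Submodule.mem_map_of_mem hx'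
        obtain ⟨u', hu', hcu'⟩ := Submodule.mem_map.1 hcu
        have hπu' : π u' = 0 := by
          refine Submodule.span_induction (p := fun y _ => π y = 0) ?_ ?_ ?_ ?_ hu'
          · rintro _ ⟨j, rfl⟩; exact hπw _
          · exact map_zero π
          · intro a b _ _ ha hb; rw [map_add, ha, hb, add_zero]
          · intro k a _ ha; rw [map_zsmul, ha, smul_zero]
        have e1 := hker _ hu
        have e2 := hker _ hπu'
        have e3 : x - nx • (1 : A) = u' := by rw [e1, e2, hcu']
        have hxW : x = nx • (1 : A) + u' := by rw [← e3]; abel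
        rw [hxW]
        exact Submodule.add_mem _ (Submodule.smul_mem _ nx (Submodule.subset_span (Set.mem_insert _ _)))
          (Submodule.span_mono (Set.subset_insert _ _) hu')
    · intro hW
      rw [← hW, hmapW]
  refine (existsUnique_congr fun α => ?_).1 (existsUnique_basis_centered_lower hfull)
  exact and_congr_right fun _ => and_congr_right fun _ => and_congr_right fun _ => key α

/-- **HERTLING–LARABI (10.4) IN COORDINATES, general `n` — the unique `ℤ`-basis of an order.**  Let `π : A → ℚ` be
an algebra character of a commutative finite-dimensional `ℚ`-algebra and `v = (v₀, …, v_m)` a `ℚ`-basis with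
`v₀ = 1_A` and `π(vᵢ) = 0` for `i ≥ 1` (for `A = ℚ[a]/(aⁿ)`: `π = pr_F`, `v = a = (1, a, …, a^{n−1})`).  Then every
order `Λ` (`1 ∈ Λ`, `ΛΛ ⊆ Λ`, full) has exactly one `ℤ`-basis `(1_A, w₁, …, w_m)` with `w_j = Σ_i α_{ij} vᵢ`,
`(α_{ij})` LOWER triangular, `α_{ii} > 0` and `−α_{ii} < 2α_{ij} ≤ α_{ii}` for `i > j` — «`ℤ·1_A ⊂ Λ ⊂ ℤ·1_A ⊕ N`
… It has a unique `ℤ`-basis of the shape `a·(1 0 ⋯ 0; 0 α₂₂ ⋱ ⋮; ⋮ ⋮ ⋱ 0; 0 α_{n2} ⋯ α_{nn})` with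
`α_{ii} ∈ ℚ_{>0}` … and `α_{ij} ∈ (−½α_{ii}, ½α_{ii}] ∩ ℚ` for `i > j ≥ 2`. (10.4)»: precisely, there is exactly one
such `α` with `span ℤ ({1} ∪ {w_j}) = Λ` (PROOF: `π(Λ) = ℤ`, so `Λ = ℤ·1 ⊕ (Λ ∩ ker π)`, and the coordinates
`(v.repr · i)_{i ≥ 1}` carry `Λ` onto a full lattice of `ℚᵐ`, to which §1 applies).
[cite: HertlingLarabi2026b, §10.1 (10.4) with the proof of Lemma 10.1, chunk p0033] -/
theorem existsUnique_order_coords_centered_lower (π : A →ₐ[ℚ] ℚ) {m : ℕ} (v : Basis (Fin (m + 1)) ℚ A)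
    (hv0 : v 0 = 1) (hvπ : ∀ i : Fin m, π (v i.succ) = 0) {Λ : Submodule ℤ A} (hΛ : IsFullLattice A Λ)
    (h1 : (1 : A) ∈ Λ) (hΛΛ : Λ * Λ ≤ Λ) :
    ∃! α : Matrix (Fin m) (Fin m) ℚ, (∀ i j, i < j → α i j = 0) ∧ (∀ i, 0 < α i i) ∧
      (∀ i j, j < i → -α i i < 2 * α i j ∧ 2 * α i j ≤ α i i) ∧
      span ℤ (insert (1 : A) (Set.range fun j => ∑ i, α i j • v i.succ)) = Λ :=
  existsUnique_coords_centered_lower_of_one_mem π v hv0 hvπ hΛ h1 fun _ hx =>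
    exists_intCast_eq_map_of_one_mem π hΛ.1 h1 hΛΛ hx

end Orders

/-! ## §6 (10.2) and (10.4) AS PRINTED: `A = ℚ[a]/(aⁿ)` with the basis `a = (1, a, …, a^{n−1})`

HL's algebra (10.1) is `AdjoinRoot ((X : ℚ[X]) ^ n)` (as in `FiniteQAlgebraLatticeRadicalProjectionInjective` §4,
Lemma 10.1 as printed), `a = AdjoinRoot.root _`, and `a = (1, a, …, a^{n−1})` is the power basis. -/

section Truncated

open Polynomial

/-- **(10.2) AS PRINTED**: in `A = ℚ·1_A ⊕ ℚ·a + ⋯ + ℚ·a^{n−1}`, `aⁿ = 0`, «each full lattice `L ∈ 𝓛(A)` has a unique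
`ℤ`-basis of the shape `a·(β_{ij})` [lower triangular] with `β_{ii} ∈ ℚ_{>0}` for `1 ≤ i ≤ n` and
`β_{ij} ∈ (−½β_{ii}, ½β_{ii}] ∩ ℚ` for `i > j`»: exactly one such `β` with `span ℤ {Σ_i β_{ij} a^i}_j = L`
(indices from `0`: the basis vector `j` is `Σ_{i=0}^{n−1} β_{ij} aⁱ`). [cite: HertlingLarabi2026b, §10.1 (10.1)–(10.2), chunk p0033] -/
theorem adjoinRoot_X_pow_existsUnique_coords_centered_lower (n : ℕ)
    {L : Submodule ℤ (AdjoinRoot ((X : ℚ[X]) ^ n))} (hL : IsFullLattice (AdjoinRoot ((X : ℚ[X]) ^ n)) L) :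
    ∃! β : Matrix (Fin n) (Fin n) ℚ, (∀ i j, i < j → β i j = 0) ∧ (∀ i, 0 < β i i) ∧
      (∀ i j, j < i → -β i i < 2 * β i j ∧ 2 * β i j ≤ β i i) ∧
      span ℤ (Set.range fun j => ∑ i : Fin n, β i j • AdjoinRoot.root ((X : ℚ[X]) ^ n) ^ (i : ℕ)) = L := by
  have hdim : (AdjoinRoot.powerBasis' (monic_X_pow n : ((X : ℚ[X]) ^ n).Monic)).dim = n := by
    rw [AdjoinRoot.powerBasis'_dim, natDegree_X_pow]
  let v : Basis (Fin n) ℚ (AdjoinRoot ((X : ℚ[X]) ^ n)) :=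
    (AdjoinRoot.powerBasis' (monic_X_pow n : ((X : ℚ[X]) ^ n).Monic)).basis.reindex (finCongr hdim)
  have hv : ∀ i, v i = AdjoinRoot.root ((X : ℚ[X]) ^ n) ^ (i : ℕ) := fun i => by
    rw [Basis.reindex_apply, PowerBasis.basis_eq_pow, AdjoinRoot.powerBasis'_gen, finCongr_symm,
      finCongr_apply, Fin.val_cast]
  have h := existsUnique_coords_centered_lower v hL
  simp only [hv] at h
  exact h

/-- **(10.4) AS PRINTED**: in `A = ℚ·1_A ⊕ ℚ·a + ⋯ + ℚ·a^{n−1}`, `aⁿ = 0`, `n = m + 1 ≥ 1`, «each order `Λ` […] has a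
unique `ℤ`-basis of the shape `a·(1 0 ⋯ 0; 0 α₂₂ ⋱ ⋮; ⋮ ⋮ ⋱ 0; 0 α_{n2} ⋯ α_{nn})` with `α_{ii} ∈ ℚ_{>0}` … and
`α_{ij} ∈ (−½α_{ii}, ½α_{ii}] ∩ ℚ` for `i > j ≥ 2`»: for an order `Λ` (`1 ∈ Λ`, `ΛΛ ⊆ Λ`, full) there is exactly
one lower triangular `α ∈ M_m(ℚ)` with `α_{ii} > 0`, `−α_{ii} < 2α_{ij} ≤ α_{ii}` (`i > j`) such that
`span ℤ ({1} ∪ {Σ_{i=1}^{m} α_{ij} aⁱ}_j) = Λ` (the character is `a ↦ 0`).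
[cite: HertlingLarabi2026b, §10.1 (10.4), chunk p0033] -/
theorem adjoinRoot_X_pow_existsUnique_order_coords (m : ℕ)
    {Λ : Submodule ℤ (AdjoinRoot ((X : ℚ[X]) ^ (m + 1)))} (hΛ : IsFullLattice (AdjoinRoot ((X : ℚ[X]) ^ (m + 1))) Λ)
    (h1 : (1 : AdjoinRoot ((X : ℚ[X]) ^ (m + 1))) ∈ Λ) (hΛΛ : Λ * Λ ≤ Λ) :
    ∃! α : Matrix (Fin m) (Fin m) ℚ, (∀ i j, i < j → α i j = 0) ∧ (∀ i, 0 < α i i) ∧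
      (∀ i j, j < i → -α i i < 2 * α i j ∧ 2 * α i j ≤ α i i) ∧
      span ℤ (insert (1 : AdjoinRoot ((X : ℚ[X]) ^ (m + 1)))
        (Set.range fun j => ∑ i : Fin m, α i j • AdjoinRoot.root ((X : ℚ[X]) ^ (m + 1)) ^ ((i : ℕ) + 1))) = Λ := by
  have hdim : (AdjoinRoot.powerBasis' (monic_X_pow (m + 1) : ((X : ℚ[X]) ^ (m + 1)).Monic)).dim = m + 1 := by
    rw [AdjoinRoot.powerBasis'_dim, natDegree_X_pow]
  let v : Basis (Fin (m + 1)) ℚ (AdjoinRoot ((X : ℚ[X]) ^ (m + 1))) :=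
    (AdjoinRoot.powerBasis' (monic_X_pow (m + 1) : ((X : ℚ[X]) ^ (m + 1)).Monic)).basis.reindex (finCongr hdim)
  have hv : ∀ i, v i = AdjoinRoot.root ((X : ℚ[X]) ^ (m + 1)) ^ (i : ℕ) := fun i => by
    rw [Basis.reindex_apply, PowerBasis.basis_eq_pow, AdjoinRoot.powerBasis'_gen, finCongr_symm,
      finCongr_apply, Fin.val_cast]
  -- the character `a ↦ 0`
  let π : AdjoinRoot ((X : ℚ[X]) ^ (m + 1)) →ₐ[ℚ] ℚ :=
    AdjoinRoot.liftAlgHom ((X : ℚ[X]) ^ (m + 1)) (Algebra.ofId ℚ ℚ) 0 (by simp)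
  have hroot : π (AdjoinRoot.root ((X : ℚ[X]) ^ (m + 1))) = 0 := by
    have h0 : AdjoinRoot.root ((X : ℚ[X]) ^ (m + 1)) ^ (m + 1) = 0 := by
      rw [← AdjoinRoot.mk_X, ← map_pow, AdjoinRoot.mk_self]
    have h := congrArg π h0
    rw [map_pow, map_zero] at h
    exact (pow_eq_zero_iff (Nat.succ_ne_zero m)).1 h
  have hv0 : v 0 = 1 := by rw [hv, Fin.val_zero, pow_zero]
  have hvπ : ∀ i : Fin m, π (v i.succ) = 0 := fun i => by
    rw [hv, map_pow, hroot, Fin.val_succ, pow_succ, mul_zero]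
  have h := existsUnique_order_coords_centered_lower π v hv0 hvπ hΛ h1 hΛΛ
  simp only [hv, Fin.val_succ] at h
  exact h

end Truncated

/-! ## §7 (10.3): the semi-normal form of an `ε`-class in a local algebra (existence)

«Multiplication of `L` with the unit `u = (Σ_{i=1}^n β_{i1} a^{i−1})⁻¹ ∈ A^{unit}` leads to the full lattice `uL`
which has a `ℤ`-basis of the shape `a·(1 0 ⋯ 0; 0 γ₂₂ ⋱ ⋮; ⋮ ⋮ ⋱ 0; 0 γ_{n2} ⋯ γ_{nn})` with `γ_{ii} ∈ ℚ_{>0}` for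
`2 ≤ i ≤ n` and `γ_{ij} ∈ (−½γ_{ii}, ½γ_{ii}] ∩ ℚ` for `i > j ≥ 2` (10.3).  Though this is not unique. It is only a
semi-normal form» (chunk p0033).  The first basis vector `b₁ = Σ β_{i1} a^{i−1}` of (10.2) is a unit BECAUSE
`β₁₁ ≠ 0` and `a` is nilpotent: the argument works in every commutative finite-dimensional `ℚ`-algebra which is
LOCAL with residue field `ℚ` (the kernel of the character `π` consists of nilpotent elements — the hypothesis of
`FiniteQAlgebraLatticeRadicalProjectionInjective` §3–§4), for every basis `v = (1, v₁, …, v_m)` with `vᵢ ∈ ker π`. -/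

section SemiNormal

variable {A : Type} [CommRing A] [Algebra ℚ A]

open Literature.NumberTheory.Automorphic (mem_units_smul_submodule_iff)
open Literature.NumberTheory.ComplexMultiplication.FiniteQAlgebraLattice (isUnit_of_isUnit_map_of_forall_isNilpotent
  adjoinRoot_X_pow_isNilpotent_of_map_eq_zero)

omit [Algebra ℚ A] in
/-- `uM` is a full lattice for a full lattice `M` and a unit `u`. [cite: HertlingLarabi2026b, §4 Def. 4.1 (a) and
§5 Def. 5.1 (a) (`ε`-classes consist of full lattices), chunks p0007, p0009] -/
theorem isFullLattice_units_smul (u : Aˣ) {M : Submodule ℤ A} (hM : IsFullLattice A M) : IsFullLattice A (u • M) := by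
  refine ⟨?_, fun d => ?_⟩
  · rw [Units.smul_def]
    exact hM.1.map _
  · obtain ⟨n, hn, hnd⟩ := hM.2 ((u⁻¹ : Aˣ) • d)
    refine ⟨n, hn, mem_units_smul_submodule_iff.2 ?_⟩
    rwa [smul_comm]

/-- `π(Σ_i yᵢ vᵢ) = y₀` for a basis `v = (1, v₁, …, v_m)` with `vᵢ ∈ ker π`. [folklore] -/
private theorem map_sum_smul_eq (π : A →ₐ[ℚ] ℚ) {m : ℕ} (v : Basis (Fin (m + 1)) ℚ A) (hv0 : v 0 = 1)
    (hvπ : ∀ i : Fin m, π (v i.succ) = 0) (y : Fin (m + 1) → ℚ) : π (∑ i, y i • v i) = y 0 := by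
  rw [map_sum, Fin.sum_univ_succ, Finset.sum_eq_zero (fun i _ => by rw [map_smul, hvπ, smul_zero]), add_zero,
    map_smul, hv0, map_one, smul_eq_mul, mul_one]

/-- **HERTLING–LARABI (10.3) IN COORDINATES, general `n` — the semi-normal form of an `ε`-class (existence).**  Let
`A` be a commutative finite-dimensional `ℚ`-algebra, `π : A →ₐ[ℚ] ℚ` a character whose kernel consists of
nilpotent elements (`A` local with residue field `ℚ`, e.g. `ℚ[a]/(aⁿ)`), and `v = (v₀, …, v_m)` a `ℚ`-basis with
`v₀ = 1`, `π(vᵢ) = 0` (`i ≥ 1`).  For every full lattice `L` there is a unit `u` — the inverse of the first vector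
`b₀ ∈ L` of the basis (10.2) of `L` — such that `uL` has a `ℤ`-basis `(1, w₁, …, w_m)`, `w_j = Σ_i γ_{ij} vᵢ` with
`γ` lower triangular, `γ_{ii} > 0`, `−γ_{ii} < 2γ_{ij} ≤ γ_{ii}` (`i > j`); for this `u` the matrix `γ` is unique
(but `u` is not: «only a semi-normal form»). [cite: HertlingLarabi2026b, §10.1 (10.3), chunk p0033] -/
theorem exists_units_smul_existsUnique_coords_semiNormal (π : A →ₐ[ℚ] ℚ) (hnil : ∀ x, π x = 0 → IsNilpotent x)
    {m : ℕ} (v : Basis (Fin (m + 1)) ℚ A) (hv0 : v 0 = 1) (hvπ : ∀ i : Fin m, π (v i.succ) = 0)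
    {L : Submodule ℤ A} (hL : IsFullLattice A L) :
    ∃ u : Aˣ, ((u⁻¹ : Aˣ) : A) ∈ L ∧
      ∃! γ : Matrix (Fin m) (Fin m) ℚ, (∀ i j, i < j → γ i j = 0) ∧ (∀ i, 0 < γ i i) ∧
        (∀ i j, j < i → -γ i i < 2 * γ i j ∧ 2 * γ i j ≤ γ i i) ∧
        span ℤ (insert (1 : A) (Set.range fun j => ∑ i, γ i j • v i.succ)) = u • L := by
  classical
  -- the basis (10.2) of `L` in the coordinates `v`
  obtain ⟨β, ⟨hT, hpos, -, hspan⟩, -⟩ := existsUnique_coords_centered_lower v hL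
  set b : Fin (m + 1) → A := fun j => ∑ i, β i j • v i with hb
  have hπb : ∀ j, π (b j) = β 0 j := fun j => map_sum_smul_eq π v hv0 hvπ _
  -- `b₀` is a unit: `π(b₀) = β₀₀ ≠ 0` and `ker π` is nil
  have hsurj : Function.Surjective (π : A →+* ℚ) := fun q => ⟨algebraMap ℚ A q, π.commutes q⟩
  have hb0 : IsUnit (b 0) := by
    refine isUnit_of_isUnit_map_of_forall_isNilpotent hsurj (fun x hx => hnil x hx) ?_
    show IsUnit (π (b 0))
    rw [hπb]
    exact isUnit_iff_ne_zero.2 (hpos 0).ne'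
  set w : Aˣ := hb0.unit with hw
  have hwval : (w : A) = b 0 := hb0.unit_spec
  refine ⟨w⁻¹, ?_, ?_⟩
  · rw [inv_inv, hwval, ← hspan]
    exact Submodule.subset_span ⟨0, rfl⟩
  -- `w⁻¹L = span {w⁻¹ b_j}`, `w⁻¹ b₀ = 1`, `π(w⁻¹ b_{j+1}) = 0`
  have hΛ : (w⁻¹ • L : Submodule ℤ A) = span ℤ (Set.range fun j => ((w⁻¹ : Aˣ) : A) * b j) := by
    rw [← hspan, Units.smul_def, Submodule.smul_span, Set.smul_set_range]
    rfl
  have hub0 : ((w⁻¹ : Aˣ) : A) * b 0 = 1 := by rw [← hwval, Units.inv_mul]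
  have hπub : ∀ j : Fin m, π (((w⁻¹ : Aˣ) : A) * b j.succ) = 0 := fun j => by
    rw [map_mul, hπb, hT 0 j.succ (Fin.succ_pos j), mul_zero]
  have hfull : IsFullLattice A (w⁻¹ • L) := isFullLattice_units_smul _ hL
  have h1 : (1 : A) ∈ (w⁻¹ • L : Submodule ℤ A) := by
    rw [hΛ, ← hub0]; exact Submodule.subset_span ⟨0, rfl⟩
  have hint : ∀ x ∈ (w⁻¹ • L : Submodule ℤ A), ∃ n : ℤ, (n : ℚ) = π x := by
    intro x hx
    rw [hΛ] at hx
    refine Submodule.span_induction (p := fun y _ => ∃ n : ℤ, (n : ℚ) = π y) ?_ ?_ ?_ ?_ hx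
    · rintro _ ⟨j, rfl⟩
      rcases Fin.eq_zero_or_eq_succ j with rfl | ⟨j, rfl⟩
      · exact ⟨1, by beta_reduce; rw [hub0, map_one, Int.cast_one]⟩
      · exact ⟨0, by beta_reduce; rw [hπub, Int.cast_zero]⟩
    · exact ⟨0, by rw [map_zero, Int.cast_zero]⟩
    · rintro a c _ _ ⟨k, hk⟩ ⟨l, hl⟩
      exact ⟨k + l, by rw [map_add, ← hk, ← hl, Int.cast_add]⟩
    · rintro k a _ ⟨l, hl⟩
      exact ⟨k * l, by rw [map_zsmul, ← hl, zsmul_eq_mul, Int.cast_mul]⟩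
  exact existsUnique_coords_centered_lower_of_one_mem π v hv0 hvπ hfull h1 hint

end SemiNormal

section TruncatedSemiNormal

open Polynomial

open Literature.NumberTheory.ComplexMultiplication.FiniteQAlgebraLattice (adjoinRoot_X_pow_isNilpotent_of_map_eq_zero)

/-- The power basis `a = (1, a, …, a^{n−1})` of `ℚ[a]/(aⁿ) = AdjoinRoot (X ^ n)`, indexed by `Fin n`. [folklore] -/
private theorem adjoinRoot_X_pow_exists_basis (n : ℕ) :
    ∃ v : Basis (Fin n) ℚ (AdjoinRoot ((X : ℚ[X]) ^ n)), ∀ i, v i = AdjoinRoot.root ((X : ℚ[X]) ^ n) ^ (i : ℕ) := by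
  have hdim : (AdjoinRoot.powerBasis' (monic_X_pow n : ((X : ℚ[X]) ^ n).Monic)).dim = n := by
    rw [AdjoinRoot.powerBasis'_dim, natDegree_X_pow]
  refine ⟨(AdjoinRoot.powerBasis' (monic_X_pow n : ((X : ℚ[X]) ^ n).Monic)).basis.reindex (finCongr hdim),
    fun i => ?_⟩
  rw [Basis.reindex_apply, PowerBasis.basis_eq_pow, AdjoinRoot.powerBasis'_gen, finCongr_symm, finCongr_apply,
    Fin.val_cast]

/-- The character `a ↦ 0` of `ℚ[a]/(aⁿ)`, `n ≥ 1` (every character kills the nilpotent `a`). [folklore] -/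
private theorem adjoinRoot_X_pow_exists_character (m : ℕ) :
    ∃ π : AdjoinRoot ((X : ℚ[X]) ^ (m + 1)) →ₐ[ℚ] ℚ, π (AdjoinRoot.root ((X : ℚ[X]) ^ (m + 1))) = 0 := by
  refine ⟨AdjoinRoot.liftAlgHom ((X : ℚ[X]) ^ (m + 1)) (Algebra.ofId ℚ ℚ) 0 (by simp), ?_⟩
  set π := AdjoinRoot.liftAlgHom ((X : ℚ[X]) ^ (m + 1)) (Algebra.ofId ℚ ℚ) 0 (by simp)
  have h0 : AdjoinRoot.root ((X : ℚ[X]) ^ (m + 1)) ^ (m + 1) = 0 := by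
    rw [← AdjoinRoot.mk_X, ← map_pow, AdjoinRoot.mk_self]
  have h := congrArg π h0
  rw [map_pow, map_zero] at h
  exact (pow_eq_zero_iff (Nat.succ_ne_zero m)).1 h

/-- **(10.3) AS PRINTED** for `A = ℚ·1_A ⊕ ℚ·a + ⋯ + ℚ·a^{n−1}`, `aⁿ = 0`, `n = m + 1 ≥ 1`: for every full lattice `L`
there is a unit `u` (the inverse of the first vector of the basis (10.2) of `L`, which lies in `L`) such that `uL`
has a `ℤ`-basis `a·(1 0 ⋯ 0; 0 γ₂₂ ⋱ ⋮; ⋮ ⋮ ⋱ 0; 0 γ_{n2} ⋯ γ_{nn})` — i.e. `(1, Σ_{i=1}^m γ_{ij} aⁱ)_j` — with `γ`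
lower triangular, «`γ_{ii} ∈ ℚ_{>0}` for `2 ≤ i ≤ n` and `γ_{ij} ∈ (−½γ_{ii}, ½γ_{ii}] ∩ ℚ` for `i > j ≥ 2`»; `γ` is
unique for this `u` («Though this is not unique. It is only a semi-normal form»: `u` may vary).
[cite: HertlingLarabi2026b, §10.1 (10.3), chunk p0033] -/
theorem adjoinRoot_X_pow_exists_units_smul_semiNormal (m : ℕ)
    {L : Submodule ℤ (AdjoinRoot ((X : ℚ[X]) ^ (m + 1)))} (hL : IsFullLattice (AdjoinRoot ((X : ℚ[X]) ^ (m + 1))) L) :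
    ∃ u : (AdjoinRoot ((X : ℚ[X]) ^ (m + 1)))ˣ,
      ((u⁻¹ : (AdjoinRoot ((X : ℚ[X]) ^ (m + 1)))ˣ) : AdjoinRoot ((X : ℚ[X]) ^ (m + 1))) ∈ L ∧
      ∃! γ : Matrix (Fin m) (Fin m) ℚ, (∀ i j, i < j → γ i j = 0) ∧ (∀ i, 0 < γ i i) ∧
        (∀ i j, j < i → -γ i i < 2 * γ i j ∧ 2 * γ i j ≤ γ i i) ∧
        span ℤ (insert (1 : AdjoinRoot ((X : ℚ[X]) ^ (m + 1)))
          (Set.range fun j => ∑ i : Fin m, γ i j • AdjoinRoot.root ((X : ℚ[X]) ^ (m + 1)) ^ ((i : ℕ) + 1))) =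
          u • L := by
  obtain ⟨v, hv⟩ := adjoinRoot_X_pow_exists_basis (m + 1)
  obtain ⟨π, hroot⟩ := adjoinRoot_X_pow_exists_character m
  have hv0 : v 0 = 1 := by rw [hv, Fin.val_zero, pow_zero]
  have hvπ : ∀ i : Fin m, π (v i.succ) = 0 := fun i => by
    rw [hv, map_pow, hroot, Fin.val_succ, pow_succ, mul_zero]
  have h := exists_units_smul_existsUnique_coords_semiNormal π
    (fun x hx => adjoinRoot_X_pow_isNilpotent_of_map_eq_zero π hx) v hv0 hvπ hL
  simp only [hv, Fin.val_succ] at h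
  exact h

end TruncatedSemiNormal


end Literature.NumberTheory.ComplexMultiplication.FiniteQAlgebraLattice.TriangularBases
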